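import Literature.AnabelianGeometry.SemiGraphs.PSCUnrVerticialSeparatingCoveringsThreeChain
import Literature.AnabelianGeometry.SemiGraphs.PSCThreeChainUnramified
import HarnessLib

/-!
# [CombGC] Prop. 1.2 (ii) IN FULL (sturdy `Π^unr`-clause included) at the origin of the three-component CHAIN data

Mochizuki, *A combinatorial version of the Grothendieck conjecture*, Tohoku Math. J. **59** (2007)
[CombGC], Prop. 1.2 p. 8 [cite: MochizukiCombGC2007, Prop 1.2 pp.8-9]: (ii) "the `Aᵢ` are commensurably
terminal in `Π_G`; … [for `G` sturdy] the `Bᵢ` are commensurably terminal in `Π^unr_G`".  abc-iut FACT-LIST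
row F-0438 `PSCDatum.CommensurableTerminalityHolds` (schema over `Ω : PSCOrigin`, abc-iut-L3-t4; universal
closure refuted, instance forms at genuine carriers are the content), with F-0459 / F-0440 / F-0443 / F-1931 /
F-0458 re-assembled from gen 3.

PROOF-ONLY assembly file (abc-iut-f-164 gen 4).  Gen 3 of this seat proved every [CombGC] §1 row at the
origin of the THREE-COMPONENT CHAIN data (`PSCThreeChainOrigin.lean`, `PSCThreeChainUnramified.lean`:
`C₀ ∪_{ν_A} C_mid ∪_{ν_B} C₁`, two nodes, three vertices, any genera) EXCEPT the sturdy `Π^unr`-clause of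
Prop. 1.2 (ii), for which the tree then had no engine.  `PSCUnrVerticialSeparatingCoveringsThreeChain.lean`
(this gen: the `Π^unr`-separating coverings at the chain via the chain Tietze isomorphism
`Γ/⟨⟨c_j, ε_A, η⟩⟩ ≅ Γ_{g₀,0} ∗ (Γ_{g₁−g₀,0} ∗ Γ_{g−g₁,0})`, abc-iut-f-166's fibred twist and abc-iut-w5-d047's
transfer) and abc-iut-w5-d183's `unrVerticialCommensurablyTerminal_of_separating` supply it.  Hence:

* `threeChainOrigin_prop12_rows` — at every origin of three-component chain data (gen 3's origin hypothesis,
  genera and `nodeEnds` recorded; universe `0`): `CommensurableTerminalityHolds Ω` (F-0438, BOTH clauses, no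
  genus restriction) ∧ `OpenInterDeterminesComponentHolds Ω` (F-0459, gen 3) ∧ the `Π^unr`-separating
  coverings (F-2828) datum-wise;
* `exists_threeChainOrigin_prop12_holds_all` — capstone: the origin of ALL three-component chain data with
  `Σ = {l}` — inhabited for every splitting `g₀ ≤ g₁ ≤ g`, `2 ≤ s₁`, `s₁ + 2 ≤ s₂`, `s₂ + 2 ≤ r`, in
  particular by the STURDY chain of genera `(2,2,2)` over `Γ_{6,6}` — satisfies F-0438 ∧ F-0459 ∧ F-0440 ∧
  F-0443 ∧ F-1931 ∧ F-0458 (gen 3's `exists_threeChainOrigin_holds'` plus F-0438 in full; its earlier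
  `exists_threeChainOrigin_holds` needed a component of genus `< 2` for F-0438).

F-0461 (Thm. 1.6 (iii)) is not vacuous at sturdy chains and is not treated.  Instance forms at data of the
shape of genuine two-node curves: consistency evidence for the typed schemata, not the printed theorems for
all pointed stable curves (cell FOUNDATIONS rows 13–14).  0 definitions; nothing here takes a side on
[IUTchIII] Cor. 3.12.
-/

noncomputable section

namespace Literature.AnabelianGeometry.SemiGraphs

open scoped Pointwise
open Literature.GroupTheory.CombinatorialGroupTheory
open SemiGraphOfAnabelioids (IsProSigmaCompletion)

namespace PSCDatum

/-! ### F-0438 in full at every origin of three-component chain data -/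

/-- **F-0438 `CommensurableTerminalityHolds Ω` (BOTH clauses), F-0459 `OpenInterDeterminesComponentHolds Ω`
and row F-2828 (the `Π^unr`-separating coverings, datum-wise) at EVERY origin of three-component chain
data** (gen 3's origin hypothesis over profinite pro-`Σ` completions of `Γ_{g,r}` in `Type`; genera and
`nodeEnds` recorded; NO genus restriction — sturdy chains covered). [cite: MochizukiCombGC2007, Prop 1.2 pp.8-9] -/
theorem threeChainOrigin_prop12_rows (Ω : PSCOrigin.{0})
    (hΩ : ∀ ⦃Q : Type⦄ [Group Q] [TopologicalSpace Q] (G : PSCDatum Q),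
      Ω.IsOfPSCType G → ∃ (_ : IsTopologicalGroup Q), CompactSpace Q ∧ T2Space Q ∧
        TotallyDisconnectedSpace Q ∧
        ∃ (S : Set ℕ) (g r g₀ g₁ s₁ s₂ : ℕ) (ι : PuncturedSurfaceGroup g r →* Q) (e : G.graph.C ≃ Fin r)
          (v₀ vm v₁ : G.graph.V) (nA nB : G.graph.N) (εA η : PuncturedSurfaceGroup g r),
          S.Nonempty ∧ (∀ p ∈ S, p.Prime) ∧ IsProSigmaCompletion S ι ∧ g₀ ≤ g₁ ∧ g₁ ≤ g ∧ 2 ≤ s₁ ∧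
          s₁ + 2 ≤ s₂ ∧ s₂ + 2 ≤ r ∧
          (∀ c, G.cuspGp c =
            ((PuncturedSurfaceGroup.cuspInertia (g := g) (e c)).map ι).topologicalClosure) ∧
          (∀ w, w = v₀ ∨ w = vm ∨ w = v₁) ∧ (∀ n, n = nA ∨ n = nB) ∧
          εA = ((List.finRange r).map fun j : Fin r =>
              if s₂ ≤ (j : ℕ) then PuncturedSurfaceGroup.c (g := g) j else 1).prod *
            ((List.finRange g).map fun i : Fin g => if (i : ℕ) < g₀ then
              PuncturedSurfaceGroup.a (r := r) i * PuncturedSurfaceGroup.b i *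
                (PuncturedSurfaceGroup.a i)⁻¹ * (PuncturedSurfaceGroup.b i)⁻¹ else 1).prod ∧
          η = ((List.finRange r).map fun j : Fin r =>
              if s₁ ≤ (j : ℕ) then PuncturedSurfaceGroup.c (g := g) j else 1).prod *
            ((List.finRange g).map fun i : Fin g => if (i : ℕ) < g₁ then
              PuncturedSurfaceGroup.a (r := r) i * PuncturedSurfaceGroup.b i *
                (PuncturedSurfaceGroup.a i)⁻¹ * (PuncturedSurfaceGroup.b i)⁻¹ else 1).prod ∧
          G.vertGp v₀ = ((Subgroup.closure {x : PuncturedSurfaceGroup g r |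
            (∃ i : Fin g, (i : ℕ) < g₀ ∧ (x = PuncturedSurfaceGroup.a i ∨ x = PuncturedSurfaceGroup.b i)) ∨
            ∃ j : Fin r, s₂ ≤ (j : ℕ) ∧ x = PuncturedSurfaceGroup.c j}).map ι).topologicalClosure ∧
          G.vertGp vm = ((Subgroup.closure {x : PuncturedSurfaceGroup g r |
            (∃ i : Fin g, (g₀ ≤ (i : ℕ) ∧ (i : ℕ) < g₁) ∧
              (x = PuncturedSurfaceGroup.a i ∨ x = PuncturedSurfaceGroup.b i)) ∨
            (∃ j : Fin r, (s₁ ≤ (j : ℕ) ∧ (j : ℕ) < s₂) ∧ x = PuncturedSurfaceGroup.c j) ∨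
            x = εA ∨ x = η}).map ι).topologicalClosure ∧
          G.vertGp v₁ = ((Subgroup.closure {x : PuncturedSurfaceGroup g r |
            (∃ i : Fin g, g₁ ≤ (i : ℕ) ∧ (x = PuncturedSurfaceGroup.a i ∨ x = PuncturedSurfaceGroup.b i)) ∨
            (∃ j : Fin r, (j : ℕ) < s₁ ∧ x = PuncturedSurfaceGroup.c j) ∨ x = η}).map ι).topologicalClosure ∧
          G.nodeGp nA = ((Subgroup.zpowers εA).map ι).topologicalClosure ∧
          G.nodeGp nB = ((Subgroup.zpowers η).map ι).topologicalClosure ∧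
          G.graph.nodeEnds nA = s(v₀, vm) ∧ G.graph.nodeEnds nB = s(vm, v₁) ∧
          G.genus v₀ = g₀ ∧ G.genus vm = g₁ - g₀ ∧ G.genus v₁ = g - g₁) :
    CommensurableTerminalityHolds Ω ∧ OpenInterDeterminesComponentHolds Ω ∧
      ∀ ⦃Q : Type⦄ [Group Q] [TopologicalSpace Q] [IsTopologicalGroup Q] (G : PSCDatum Q),
        Ω.IsOfPSCType G → G.UnrVerticialSeparatingCoverings := by
  obtain ⟨h12i, -, -, -, h12ii, -⟩ := threeChainOrigin_rows' Ω hΩ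
  have hunr : ∀ ⦃Q : Type⦄ [Group Q] [TopologicalSpace Q] [IsTopologicalGroup Q] (G : PSCDatum Q),
      Ω.IsOfPSCType G → G.UnrVerticialSeparatingCoverings := fun Q _ _ _ G hG => by
    obtain ⟨_, hcQ, htQ, hdQ, S, g, r, g₀, g₁, s₁, s₂, ι, e, v₀, vm, v₁, nA, nB, εA, η, hne, hprime, hι, hg,
      hg₁, hs₁, hs₁₂, hs₂, hC, hV, hN, hεA, hη, hV₀, hVm, hV₁, hEA, hEB, -, -, hgen₀, hgenm, hgen₁⟩ := hΩ G hG
    haveI := hcQ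
    haveI := htQ
    haveI := hdQ
    exact G.unrVerticialSeparatingCoverings_of_threeChain hne hprime ι hι hg hg₁ hs₁ hs₁₂ hs₂ e hC v₀ vm v₁
      hV εA η hεA hη hV₀ hVm hV₁ nA nB hN hEA hEB hgen₀ hgenm hgen₁
  refine ⟨fun Q _ _ _ G hG => ?_, h12i, hunr⟩
  obtain ⟨_, hcQ, -, hdQ, -⟩ := hΩ G hG
  haveI := hcQ
  haveI := hdQ
  exact ⟨h12ii G hG, G.unrVerticialCommensurablyTerminal_of_separating (hunr G hG)⟩

/-! ### Capstone: the inhabited origin of ALL three-component chain data with `Σ = {l}` -/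

/-- **At the origin of ALL three-component chain data with `Σ = {l}`** — inhabited for every splitting
`g₀ ≤ g₁ ≤ g`, `2 ≤ s₁`, `s₁ + 2 ≤ s₂`, `s₂ + 2 ≤ r`, in particular by the STURDY chain with genera
`(2, 2, 2)` over `Γ_{6,6}` — F-0438 ([CombGC] Prop. 1.2 (ii), BOTH clauses), F-0459 (Prop. 1.2 (i), all
clauses), F-0440 (Prop. 1.5 (i)), F-0443 (Prop. 1.5 (ii)), F-1931 ([IUTchI] Rmk. 1.2.3 (iv), cuspidal) and
F-0458 (Thm. 1.6 (i)) ALL HOLD.  (F-0461 / Thm. 1.6 (iii) is not vacuous here and is not claimed.)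
[cite: MochizukiCombGC2007, Prop 1.2 pp.8-9] [cite: MochizukiCombGC2007, Prop 1.5(ii) p.13]
[cite: MochizukiCombGC2007, Thm 1.6(i) p.13] -/
theorem exists_threeChainOrigin_prop12_holds_all (l : ℕ) (hl : l.Prime) :
    ∃ Ω : PSCOrigin.{0},
      (∀ g r g₀ g₁ s₁ s₂ : ℕ, g₀ ≤ g₁ → g₁ ≤ g → 2 ≤ s₁ → s₁ + 2 ≤ s₂ → s₂ + 2 ≤ r →
        ∃ (Q : ProfiniteGrp.{0}) (ι : PuncturedSurfaceGroup g r →* Q) (G : PSCDatum Q),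
          IsProSigmaCompletion {l} ι ∧ Ω.IsOfPSCType G ∧ G.Sigma = {l} ∧ G.graph.i = 3 ∧ G.graph.n = 2 ∧
            G.graph.r = r ∧ ∃ v₀ vm v₁ : G.graph.V, (∀ w, w = v₀ ∨ w = vm ∨ w = v₁) ∧
              G.genus v₀ = g₀ ∧ G.genus vm = g₁ - g₀ ∧ G.genus v₁ = g - g₁) ∧
      (∃ (Q : ProfiniteGrp.{0}) (G : PSCDatum Q), Ω.IsOfPSCType G ∧ G.IsSturdy ∧ G.graph.i = 3 ∧
        G.graph.n = 2) ∧
      CommensurableTerminalityHolds Ω ∧ OpenInterDeterminesComponentHolds Ω ∧ EdgeLikeIncidenceHolds Ω ∧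
      GraphicIffEdgeLikeVerticialHolds Ω ∧ CuspidalEdgeLikeCharacterizationHolds Ω ∧
      NumericallyCuspidalIffHolds Ω := by
  classical
  let Ω : PSCOrigin.{0} :=
    ⟨fun {Q} _ _ G => G.Sigma = {l} ∧ ∃ (_ : IsTopologicalGroup Q),
      CompactSpace Q ∧ T2Space Q ∧ TotallyDisconnectedSpace Q ∧
      ∃ (S : Set ℕ) (g r g₀ g₁ s₁ s₂ : ℕ) (ι : PuncturedSurfaceGroup g r →* Q) (e : G.graph.C ≃ Fin r)
        (v₀ vm v₁ : G.graph.V) (nA nB : G.graph.N) (εA η : PuncturedSurfaceGroup g r),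
        S.Nonempty ∧ (∀ p ∈ S, p.Prime) ∧ IsProSigmaCompletion S ι ∧ g₀ ≤ g₁ ∧ g₁ ≤ g ∧ 2 ≤ s₁ ∧
        s₁ + 2 ≤ s₂ ∧ s₂ + 2 ≤ r ∧
        (∀ c, G.cuspGp c =
          ((PuncturedSurfaceGroup.cuspInertia (g := g) (e c)).map ι).topologicalClosure) ∧
        (∀ w, w = v₀ ∨ w = vm ∨ w = v₁) ∧ (∀ n, n = nA ∨ n = nB) ∧
        εA = ((List.finRange r).map fun j : Fin r =>
            if s₂ ≤ (j : ℕ) then PuncturedSurfaceGroup.c (g := g) j else 1).prod *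
          ((List.finRange g).map fun i : Fin g => if (i : ℕ) < g₀ then
            PuncturedSurfaceGroup.a (r := r) i * PuncturedSurfaceGroup.b i *
              (PuncturedSurfaceGroup.a i)⁻¹ * (PuncturedSurfaceGroup.b i)⁻¹ else 1).prod ∧
        η = ((List.finRange r).map fun j : Fin r =>
            if s₁ ≤ (j : ℕ) then PuncturedSurfaceGroup.c (g := g) j else 1).prod *
          ((List.finRange g).map fun i : Fin g => if (i : ℕ) < g₁ then
            PuncturedSurfaceGroup.a (r := r) i * PuncturedSurfaceGroup.b i *
              (PuncturedSurfaceGroup.a i)⁻¹ * (PuncturedSurfaceGroup.b i)⁻¹ else 1).prod ∧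
        G.vertGp v₀ = ((Subgroup.closure {x : PuncturedSurfaceGroup g r |
          (∃ i : Fin g, (i : ℕ) < g₀ ∧ (x = PuncturedSurfaceGroup.a i ∨ x = PuncturedSurfaceGroup.b i)) ∨
          ∃ j : Fin r, s₂ ≤ (j : ℕ) ∧ x = PuncturedSurfaceGroup.c j}).map ι).topologicalClosure ∧
        G.vertGp vm = ((Subgroup.closure {x : PuncturedSurfaceGroup g r |
          (∃ i : Fin g, (g₀ ≤ (i : ℕ) ∧ (i : ℕ) < g₁) ∧
            (x = PuncturedSurfaceGroup.a i ∨ x = PuncturedSurfaceGroup.b i)) ∨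
          (∃ j : Fin r, (s₁ ≤ (j : ℕ) ∧ (j : ℕ) < s₂) ∧ x = PuncturedSurfaceGroup.c j) ∨
          x = εA ∨ x = η}).map ι).topologicalClosure ∧
        G.vertGp v₁ = ((Subgroup.closure {x : PuncturedSurfaceGroup g r |
          (∃ i : Fin g, g₁ ≤ (i : ℕ) ∧ (x = PuncturedSurfaceGroup.a i ∨ x = PuncturedSurfaceGroup.b i)) ∨
          (∃ j : Fin r, (j : ℕ) < s₁ ∧ x = PuncturedSurfaceGroup.c j) ∨ x = η}).map ι).topologicalClosure ∧
        G.nodeGp nA = ((Subgroup.zpowers εA).map ι).topologicalClosure ∧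
        G.nodeGp nB = ((Subgroup.zpowers η).map ι).topologicalClosure ∧
        G.graph.nodeEnds nA = s(v₀, vm) ∧ G.graph.nodeEnds nB = s(vm, v₁) ∧
        G.genus v₀ = g₀ ∧ G.genus vm = g₁ - g₀ ∧ G.genus v₁ = g - g₁⟩
  have hl' : ∀ p ∈ ({l} : Set ℕ), p.Prime := fun p hp => by
    rw [Set.mem_singleton_iff.mp hp]; exact hl
  obtain ⟨-, h15i, h15ii, hchar, -, h16i⟩ := threeChainOrigin_rows' Ω (fun Q _ _ G hG => hG.2)
  obtain ⟨h12ii, h12i, -⟩ := threeChainOrigin_prop12_rows Ω (fun Q _ _ G hG => hG.2)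
  have hmem : ∀ g r g₀ g₁ s₁ s₂ : ℕ, g₀ ≤ g₁ → g₁ ≤ g → 2 ≤ s₁ → s₁ + 2 ≤ s₂ → s₂ + 2 ≤ r →
      ∃ (Q : ProfiniteGrp.{0}) (ι : PuncturedSurfaceGroup g r →* Q) (G : PSCDatum Q),
        IsProSigmaCompletion {l} ι ∧ Ω.IsOfPSCType G ∧ G.Sigma = {l} ∧ G.graph.i = 3 ∧ G.graph.n = 2 ∧
          G.graph.r = r ∧ ∃ v₀ vm v₁ : G.graph.V, (∀ w, w = v₀ ∨ w = vm ∨ w = v₁) ∧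
            G.genus v₀ = g₀ ∧ G.genus vm = g₁ - g₀ ∧ G.genus v₁ = g - g₁ := by
    intro g r g₀ g₁ s₁ s₂ hg hg₁ hs₁ hs₁₂ hs₂
    obtain ⟨Q, ι, G, e, v₀, vm, v₁, nA, nB, εA, η, hι, hS, hi, hn, hr, hC, hV, hN, hεA, hη, hV₀, hVm, hV₁,
      hEA, hEB, hgen₀, hgenm, hgen₁, hendsA, hendsB⟩ :=
      exists_threeChainDatum {l} ⟨l, rfl⟩ hl' g r g₀ g₁ s₁ s₂
    exact ⟨Q, ι, G, hι, ⟨hS, inferInstance, inferInstance, inferInstance, inferInstance, {l}, g, r, g₀, g₁,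
      s₁, s₂, ι, e, v₀, vm, v₁, nA, nB, εA, η, ⟨l, rfl⟩, hl', hι, hg, hg₁, hs₁, hs₁₂, hs₂, hC, hV, hN, hεA,
      hη, hV₀, hVm, hV₁, hEA, hEB, hendsA, hendsB, hgen₀, hgenm, hgen₁⟩, hS, hi, hn, hr, v₀, vm, v₁, hV,
      hgen₀, hgenm, hgen₁⟩
  refine ⟨Ω, hmem, ?_, h12ii, h12i, h15i, h15ii, hchar, h16i l (fun Q _ _ _ G hG => hG.1)⟩
  obtain ⟨Q, ι, G, -, hG, -, hi, hn, -, v₀, vm, v₁, hV, hg₀, hgm, hg₁⟩ :=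
    hmem 6 6 2 4 2 4 (by norm_num) (by norm_num) le_rfl le_rfl le_rfl
  refine ⟨Q, G, hG, fun v => ?_, hi, hn⟩
  rcases hV v with rfl | rfl | rfl
  · rw [hg₀]
  · rw [hgm]
  · rw [hg₁]

end PSCDatum

end Literature.AnabelianGeometry.SemiGraphs

end
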